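import Summits.FinalStateConjecture.FinalStateConjecture.Theses.PhotonSphereChannels
import Summits.FinalStateConjecture.FinalStateConjecture.Theorems.PhotonSphereChannelsFrozenPacketMain
import Summits.FinalStateConjecture.FinalStateConjecture.Theorems.PhotonSphereChannelsExteriorEnergyRW
import Summits.FinalStateConjecture.FinalStateConjecture.Theorems.PhotonSphereChannelsEnergyInequalities

/-!
# Disproof work file — crux `UniformPhotonSphereChannelsR` (K1R; item stmt-FinalStateConjecture-14074)

Standing adversary (cdisprove) of route `PhotonSphereChannels`, seat
`refuter-cdisprove-stmt-FinalStateConjecture-14074-0`.  Prose lives in docstrings; every `theorem`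
without `sorry` is checked (`lean check` rc 0).  Findings are indexed here; numerics live in the kit
jobs cited (bundle `farkit/`: `kern.py` = far kernel by Arnoldi/variation of parameters in
arbitrary precision, validated against the closed-form flat kernel to 1e-11; `pde.py` = 6th-order
FD/RK4 far-cone energies; `famrun.py` = optimal packet in a 48-dimensional edge family).

## Reading (what K1R asks, symbol by symbol)

`∀ M > 0 ∃ ρ₀ ≥ 0 ∃ C ≥ 0 ∃ c > 0 ∀ tortoise (r, xc) ∀ s ≤ 2 ∀ ℓ ≥ s ∀ ρ ≥ ρ₀ + C·log(ℓ+1)`: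
`ChannelInequality (linePotential M s ℓ r) xc ρ c`, i.e. for EVERY global `C²` solution `φ`,
`ofReal c · kernelDeficit ≤ channelEnergy atTop + channelEnergy atBot`, where the kernel is the set
of `C²` solutions on the open two-sided cone `{ρ + |t| < |x − xc|}` that are polynomial in `t`
there — with NO energy condition (only the `t = 0` data `(a₀, a₁)` of a kernel element enter the
deficit, so the effective kernel data on the far half-line `x > x_f := xc + ρ` are
`N⁰ × N¹`, `N⁰ = {a : (∂ₓ² − V)^k a = 0, ∫ a'² + V a² < ∞}` (dim `⌊ℓ/2⌋ + 1`),
`N¹ = {a : (∂ₓ² − V)^k a = 0, a ∈ L²}` (dim `⌊(2ℓ+3)/4⌋`), spanned by the towers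
`b_i ~ x^{−ℓ+2i}`, `(∂ₓ² − V) b_i = b_{i−1}`, `b_0` = recessive static solution).  The energy is
the 1D one `∫ φ_t² + φ_x² + Vφ²` (no 3D boundary term), energies are `ℝ≥0∞` lower integrals
(infinite-energy `φ` give `⊤` on the right by backward domain of dependence, harmless), `V > 0`
for every admitted `(s, ℓ)` (no `ofReal` clipping), `0 ∈` kernel.  No junk model; agrees with the
one-shot attack note of 2026-08-16T03:06Z.

## Findings (cycle 1, 2026-08-16) — the far side under the decisive falsifier

1. *Structure.*  K1R = (near log-edge channels) ∧ (far log-edge channels) by domain of dependence;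
   the near half is landed per mode with `ρ₀(M, ℓ) = 2M log(const·(ℓ²+ℓ+1))`, `c = 1/4`
   (`Theorems.nearHalfLineChannels`), i.e. `C_near = 4M` suffices.  The only open content is the
   FAR one-ended inequality at the edge `x_f = x_c + ρ₀ + C log(ℓ+1)` with the tower kernel.
2. *Far-side frozen packets exist for every edge* (this seat; the mirror image of the landed
   `FrozenPacket.frozen_packet_main`, whose edge `xe : ℝ` is arbitrary and whose engine
   `FrozenPacket.near_energy_le_at` is generic in `V ∈ C¹, V ≥ 0`): a velocity packet `(0, g)` of
   width `w` flush inside the far edge with `1/ω ≪ w ≪ √(x_f/ω)`, `ω² = V(x_f) ≈ ℓ²/r_f²`, stays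
   within `O((w²ω/x_f) + 1/(wω))` of the motionless ansatz `g sin(ωt)/ω` while the light-speed
   edge `x_f + |t|` sweeps past it, so BOTH far channel energies are `≤ ε ∫ g²`; the window for `w`
   is non-empty iff `ω x_f ≍ ℓ ≫ 1` — independently of `x_f`, hence of `ρ₀, C`.  Consequently
   K1R holds ONLY IF the far kernel absorbs these packets:
   `dist_{L²(x_f,∞)}(g, N¹_RW)² ≤ (2ε/c) ∫ g²` (`uniformR_forces_absorption`, near-miss (e)).  On the
   near side the finite-energy kernel has zero velocity trace (landed census) and this is exactly
   how K1 died; on the far side `N¹ ≠ 0` and the question is a Müntz-type approximation problem.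
3. *Numerics: the RW far kernel DOES absorb edge rest packets, better than the flat kernel*
   (local runs of `farkit/partb.py`, velocity bumps `g = (1−u²)⁶` of half-width `w`, offset `d`
   from the edge, `s = 1`, `M = 1`, relative deficit `dist²/‖g‖²`):
   * `ℓ = 32`, `x_f = 20` (`r_f = 16.0`): flat `7.42e-2, 1.28e-2, 4.15e-3` vs RW
     `3.36e-2, 1.09e-2, 2.59e-3` for `w = 0.99, 1.98, 3.97` at `d = 0`; offsets `d = w`: flat
     `2.07e-1, 1.33e-1, 7.99e-2` vs RW `1.91e-1, 8.49e-2, 5.63e-2`.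
   * `ℓ = 64`, `x_f = 22` (`r_f = 18.3`, `ℓ M ln x_f / x_f ≈ 9`, i.e. deep in the regime where
     the Duhamel phase error of the route's worry is ≫ 1): flat `4.41e-3, 2.05e-4, 2.19e-5` vs RW
     `1.76e-3, 8.10e-5, 1.06e-5` (`w = 0.69, 1.38, 2.75`, `d = 0`); `d = w`: flat
     `4.67e-2, 7.13e-3, 8.75e-4` vs RW `2.58e-2, 3.32e-3, 5.11e-4`.
   The flat pipeline reproduces the closed-form monomial projection to `1e-11` (`ℓ = 16`) and
   `1e-8` (`ℓ = 64`, `K₁ = 32`, exact dps-214 Cholesky), the Arnoldi orthogonalisation losing only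
   ~10 digits at `ℓ = 64` (the tower basis itself has condition number ~`10^{1.6 K}`).
   *The channel side* is computed EXACTLY in the frequency domain (`spec.py`: Dirichlet wall deep
   under the barrier, standing waves `φ_ω → sin(ωx + δ)`, radiation field
   `F'(u) = −π⁻¹∫ sin(ωu − δ) ĝ dω`, `E⁺_far = 2∫_{u<−x_f} F'²`; Parseval and total flux to `1e-6`);
   the time-domain PDE is useless here (`E_far(t) = E⁺ + A/t`: marginal rays are lost only as
   `t → ∞`).  CALIBRATION: flat `ℓ = 64`, `w = 1.375`: `2E⁺/E₀ = 2.0513e-4` against the exact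
   identity value `dist²/‖g‖² = 2.0540e-4` (0.13 %).
   **The ratio `q = (E⁺ + E⁻)/dist²` for RW** (`ℓ = 64`, `x_f = 22`, `M = 1`, `s = 1`; an upper
   bound for the channel constant `c` at this `(ℓ, ρ)`):
   rest packets `w = 1.375, 2.75, 0.69` (`d = 0`): `q = 0.998, 0.985, 0.947`; `d = w`: `1.016`;
   chirped `cos(k(x−x₀))`, `k = 2.9, 5.8, 8.7, 11.6` (across the doubly-lost window edge): `0.999,
   0.998, 0.999, 1.000`; OPTIMUM over the 48-dimensional family `(1−u²)⁶ T_m(u)` on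
   `[x_f, x_f + 4.1]` (generalised eigenproblem `min 2S/D`, `D`-cutoffs `1e-3 … 1e-6`):
   `q_min = 1.00, 0.996, 0.986, 0.974` versus flat `0.999, 0.996, 0.991, 0.975` — RW ≈ flat ≈ the
   identity; no direction with small `q` exists in the edge family.
   **The defect law** (family optimum `1 − q_min` versus edge position at fixed `ℓ`; deep wall,
   sweep `h = 0.004`, `nw = 2400`, 20 Chebyshev modes on `[x_f, x_f + 6w₁]`): `ℓ = 64`:
   `x_f = 8, 12, 16` (`ρ = 6.4, 10.4, 14.4 M`) ↦ `1 − q_min = 0.05–0.07, 0.026–0.04, 0.003–0.004`;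
   the previous seats' census surplus `0.085 ℓ e^{−ρ/2M}` predicts `0.22, 0.030, 0.004` — the
   two agree wherever the defect is above the 1 % noise floor, i.e. the ONLY loss of coercivity
   on the far side is the exponentially small (in `ρ/2M`) doubly-lost sliver, linear in `ℓ`:
   along `ρ = ρ₀ + C ln ℓ` the defect is `≍ ℓ^{1−C/2M} → 0` for `C > 2M`, in particular for the
   `C = 4M` the near side needs (`ℓ = 32` at `x_f = 6`: `0.10–0.12`; kit jobs j012568/j012570 for
   `ℓ = 128, 256` queued).
4. *Why it resists.*  (i) A rest packet of width `w ≫ 1/ω` IS locally a tower: matching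
   `g sin(ωt)/ω = Σ a_{2j+1} t^{2j+1}`, `a_{2j+1} = g(−ω²)^j/(2j+1)!`, satisfies the tower recursion
   `(∂ₓ² − V) a_{2j−1} = (2j)(2j+1) a_{2j+1}` up to the frozen-packet residual `g'' − (V − ω²) g`,
   for ANY potential.  (ii) Structurally (exact reformulation): with the outgoing/incoming
   translation representations `F₊, F₋` (unitary per mode) the doubly-lost subspace is
   `L₊ ∩ L₋`, `L₊ = {F₊ ≡ 0 on u < −R}`, `L₋ = {F₋ ≡ 0 on v > R}`, and
   `E⁺ + E⁻ = ‖(1−P₊)v‖² + ‖(1−P₋)v‖² ≥ (1 − cos θ_F) dist(v, L₊ ∩ L₋)²` with `θ_F` the Friedrichs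
   angle of `(L₊, L₋)`.  In the `F₊`-picture `P₊ = 1_{u > −R}` and `P₋ = 𝒮 1_{u < R} 𝒮*`, `𝒮 =`
   the relative scattering phase `e^{2iΔδ_ℓ(ω)}`; flat: `𝒮` constant ⇒ the projections COMMUTE
   ⇒ `θ_F = π/2`, `c = 1` (Côte–Laurent's identity); RW: non-commutativity lives where the
   phase-space boundaries `u = −R` and `u = R + τ(ω)` (`τ` = time delay) cross, i.e. at
   `τ(ω₀) = −2R`, `ω₀ ≍ ℓ e^{−x_f/2M}` (turning radius `e^{x_f/2M}`), a region holding
   `≈ 0.085 ℓ e^{−ρ/2M}` cells (previous seats' census) — sub-resolution along `ρ = ρ₀ + C ln ℓ` iff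
   `C > 2M`, and the near side already needs `C ≥ 4M`.  At the edge frequencies `ω ~ ℓ/x_f` the
   boundaries are `2R + O(M ln ℓ)` apart, hence `q ≈ 1` there, as measured.  CONCLUSION OF THE
   CYCLE: no far-side refutation family is in sight; the crux's far half behaves like an
   identity with `c ≈ 1`, and the only quantitative danger is exponentially small in `ρ`.
5. *Load-bearing hypotheses* (section (a)): `C` (the log-ball) — `C = 0` is the refuted K1
   (`logFree_imp_uniformR` records the direction; informally `C ≥ 4M` is necessary: the landed
   frozen packets bite whenever `V(x_e) M² → ∞` along the family, i.e. `C < 4M`); `s ≤ ℓ`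
   (positivity of `V`; without it `(s, ℓ) = (2, 1)` has `V < 0` inside the photon sphere);
   monotonicity in `(ρ₀, C, c)` (`channelsAt_mono`) — provers may enlarge `ρ₀, C` and shrink `c`
   freely, so WLOG `C ≥ 4M`, `ρ₀ ≥ ρ_near(M)`.
-/

noncomputable section

set_option linter.dupNamespace false

namespace Summit.FinalStateConjecture.FinalStateConjecture.Cruxes.UniformPhotonSphereChannelsR.Disproof

open Literature.Geometry.Lorentzian Literature.Geometry.Lorentzian.ReggeWheeler
open Summit.FinalStateConjecture.FinalStateConjecture.Theses.PhotonSphereChannels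
open MeasureTheory Filter Set
open scoped ENNReal

/-! ## (a) Load-bearing analysis -/

/-- The conclusion of K1R at fixed parameters `(M, ρ₀, C, c)`: the log-ball channel inequality for
every tortoise radius function, every `s ≤ 2 ≤ …`, `ℓ ≥ s` and every `ρ ≥ ρ₀ + C log(ℓ+1)`. -/
def ChannelsAt (M ρ₀ C c : ℝ) : Prop :=
  ∀ (r : ℝ → ℝ) (xc : ℝ), IsTortoiseRadius M r xc → ∀ (s ℓ : ℕ), s ≤ 2 → s ≤ ℓ →
    ∀ ρ : ℝ, ρ₀ + C * Real.log ((ℓ : ℝ) + 1) ≤ ρ →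
      ChannelInequality (linePotential M s ℓ r) xc ρ c

/-- K1R is literally `∀ M > 0, ∃ ρ₀ ≥ 0, C ≥ 0, c > 0, ChannelsAt M ρ₀ C c`. -/
theorem uniformR_iff :
    UniformPhotonSphereChannelsR ↔
      ∀ M : ℝ, 0 < M → ∃ ρ₀ : ℝ, 0 ≤ ρ₀ ∧ ∃ C : ℝ, 0 ≤ C ∧ ∃ c : ℝ, 0 < c ∧ ChannelsAt M ρ₀ C c :=
  Iff.rfl

/-- **Monotonicity in the parameters.**  Enlarging the ball (`ρ₀`, `C`) or shrinking the constant
`c` weakens the claim: provers may assume WLOG `C ≥ 4M` and `ρ₀` as large as the near-side theorem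
needs, refuters must beat EVERY large `(ρ₀, C)`. -/
theorem channelsAt_mono {M ρ₀ ρ₀' C C' c c' : ℝ} (hρ : ρ₀ ≤ ρ₀') (hC : C ≤ C') (hc : c' ≤ c)
    (h : ChannelsAt M ρ₀ C c) : ChannelsAt M ρ₀' C' c' := by
  intro r xc hr s ℓ hs hsℓ ρ hρ' φ hφ
  have hlog : 0 ≤ Real.log ((ℓ : ℝ) + 1) := by
    apply Real.log_nonneg
    have : (0 : ℝ) ≤ ℓ := by exact_mod_cast Nat.zero_le ℓ
    linarith
  have hρ'' : ρ₀ + C * Real.log ((ℓ : ℝ) + 1) ≤ ρ := by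
    have := mul_le_mul_of_nonneg_right hC hlog
    linarith
  refine le_trans ?_ (h r xc hr s ℓ hs hsℓ ρ hρ'' φ hφ)
  have hcc : ENNReal.ofReal c' ≤ ENNReal.ofReal c := ENNReal.ofReal_le_ofReal hc
  gcongr

/-- The same monotonicity lifted to the existential statement: if K1R holds with witnesses
`(ρ₀, C, c)` at `M`, it holds with any `ρ₀' ≥ ρ₀`, `C' ≥ C`, `0 < c' ≤ c`. -/
theorem exists_mono {M : ℝ}
    (h : ∃ ρ₀ : ℝ, 0 ≤ ρ₀ ∧ ∃ C : ℝ, 0 ≤ C ∧ ∃ c : ℝ, 0 < c ∧ ChannelsAt M ρ₀ C c)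
    (ρ₁ C₁ : ℝ) :
    ∃ ρ₀ : ℝ, ρ₁ ≤ ρ₀ ∧ 0 ≤ ρ₀ ∧ ∃ C : ℝ, C₁ ≤ C ∧ 0 ≤ C ∧ ∃ c : ℝ, 0 < c ∧ ChannelsAt M ρ₀ C c := by
  obtain ⟨ρ₀, hρ₀, C, hC, c, hc, H⟩ := h
  refine ⟨max ρ₀ ρ₁, le_max_right _ _, hρ₀.trans (le_max_left _ _), max C C₁, le_max_right _ _,
    hC.trans (le_max_left _ _), c, hc, ?_⟩
  exact channelsAt_mono (le_max_left _ _) (le_max_left _ _) le_rfl H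

/-- **The log-free specialisation `C = 0` is K1** (item stmt-FinalStateConjecture-10045, refuted by
`Theorems.not_UniformPhotonSphereChannels`, p75070; the inlined K1 decl was dropped from the route
file at rev 7, so it is restated here over the vocabulary).  Direction recorded: the refuted
statement implies K1R, i.e. K1R is a genuine weakening and every proof of K1R must use `C > 0`
(informally `C ≥ 4M`: the landed frozen packets at the near edge `x_c − ρ` bite as soon as
`V(x_c − ρ(ℓ)) M² → ∞` along the family, and `V(x_c − ρ₀ − C ln ℓ) M² ≍ ℓ^{2 − C/2M}`). -/
def LogFree : Prop :=
  ∀ M : ℝ, 0 < M → ∃ ρ₀ : ℝ, 0 ≤ ρ₀ ∧ ∃ c : ℝ, 0 < c ∧ ChannelsAt M ρ₀ 0 c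

theorem logFree_imp_uniformR : LogFree → UniformPhotonSphereChannelsR := by
  intro h M hM
  obtain ⟨ρ₀, hρ₀, c, hc, H⟩ := h M hM
  exact ⟨ρ₀, hρ₀, 0, le_rfl, c, hc, H⟩

/-- K1R ⇒ the per-mode statement with the SAME constant `c(M)` and the explicit ball
`ρ₀ + C log(ℓ+1)`: the form in which the far-side falsifier attacks it (fix `M = 1`, `s`, and
let `ℓ → ∞` with `ρ = ρ₀ + C log(ℓ+1)`). -/
theorem perMode_of_uniformR (h : UniformPhotonSphereChannelsR) {M : ℝ} (hM : 0 < M) :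
    ∃ ρ₀ : ℝ, 0 ≤ ρ₀ ∧ ∃ C : ℝ, 0 ≤ C ∧ ∃ c : ℝ, 0 < c ∧
      ∀ (r : ℝ → ℝ) (xc : ℝ), IsTortoiseRadius M r xc → ∀ (s ℓ : ℕ), s ≤ 2 → s ≤ ℓ →
        ChannelInequality (linePotential M s ℓ r) xc (ρ₀ + C * Real.log ((ℓ : ℝ) + 1)) c := by
  obtain ⟨ρ₀, hρ₀, C, hC, c, hc, H⟩ := h M hM
  exact ⟨ρ₀, hρ₀, C, hC, c, hc, fun r xc hr s ℓ hs hsℓ => H r xc hr s ℓ hs hsℓ _ le_rfl⟩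

/-! ## (b) What a far-side kill must look like (reduction, checked) -/

/-- **The only way to use K1R against itself on the far side.**  If some global solution `φ` of
the `(s, ℓ)` Regge–Wheeler equation has two-ended channel energy `≤ ε` through the cone of
aperture `ρ ≥ ρ₀ + C log(ℓ+1)`, then K1R forces its kernel deficit below `ε / c`:
`kernelDeficit ≤ ofReal (ε/c)`... stated in `ℝ≥0∞` as `ofReal c * deficit ≤ ofReal ε`.  (Pure
logic; recorded because it is the exact interface between the Lean side — far frozen packets
with `ε → 0`, near-miss (e) — and the numerical side — the tower distance of the same packets.) -/
theorem deficit_le_of_channel_le (h : UniformPhotonSphereChannelsR) {M : ℝ} (hM : 0 < M) :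
    ∃ ρ₀ : ℝ, 0 ≤ ρ₀ ∧ ∃ C : ℝ, 0 ≤ C ∧ ∃ c : ℝ, 0 < c ∧
      ∀ (r : ℝ → ℝ) (xc : ℝ), IsTortoiseRadius M r xc → ∀ (s ℓ : ℕ), s ≤ 2 → s ≤ ℓ →
        ∀ ρ : ℝ, ρ₀ + C * Real.log ((ℓ : ℝ) + 1) ≤ ρ →
          ∀ (φ : ℝ → ℝ → ℝ) (ε : ℝ≥0∞), IsSolution (linePotential M s ℓ r) φ →
            channelEnergy (linePotential M s ℓ r) xc ρ φ atTop
              + channelEnergy (linePotential M s ℓ r) xc ρ φ atBot ≤ ε →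
            ENNReal.ofReal c * kernelDeficit (linePotential M s ℓ r) xc ρ φ ≤ ε := by
  obtain ⟨ρ₀, hρ₀, C, hC, c, hc, H⟩ := h M hM
  exact ⟨ρ₀, hρ₀, C, hC, c, hc, fun r xc hr s ℓ hs hsℓ ρ hρ φ ε hφ hε =>
    (H r xc hr s ℓ hs hsℓ ρ hρ φ hφ).trans hε⟩

/-! ## (b') Far-side frozen packets — PROVED (this seat; being landed as
`Theorems/UniformPhotonSphereChannelsR/Negative/FarFrozenPackets.lean` and `…/FarFrozenChannels.lean`;
duplicated here so that the work file is self-contained and sorry-free) -/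

section FarFrozen

open Function Topology
open Summit.FinalStateConjecture.FinalStateConjecture.Theorems
open Summit.FinalStateConjecture.FinalStateConjecture.Theorems.FrozenPacket

/-- **The far-side energy at one time** (mirror image of `near_energy_le_at`).  Let `ψ ∈ C²`
solve `ψ_tt − ψ_xx + Vψ = 0` (`V ∈ C¹`, `V ≥ 0`) with data `(0, g)`, `g ∈ C²` vanishing off
`[α, β]`, `ψ` vanishing outside the domain of influence of `[α, β]`, and let `ω > 0`, `N` with
`|(V − ω²) g − g''| ≤ ω N` everywhere.  Then for `t ∈ [0, T]` the energy of `ψ` on `(β, ∞)` is at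
most `(e − 1) T² (β − α) N²`. -/
theorem far_energy_le_at {V : ℝ → ℝ} {ψ : ℝ → ℝ → ℝ} {α β : ℝ} (hV1 : ContDiff ℝ 1 V)
    (hVnn : ∀ x, 0 ≤ V x)
    (hψ : ContDiff ℝ 2 (uncurry ψ))
    (hsol : ∀ t x, iteratedDeriv 2 (fun τ => ψ τ x) t - iteratedDeriv 2 (ψ t) x + V x * ψ t x = 0)
    (hsupp : ∀ t x, (x < α - |t| ∨ β + |t| < x) → ψ t x = 0)
    (hψ0 : ∀ x, ψ 0 x = 0) {g : ℝ → ℝ} (hψ1 : ∀ x, deriv (fun τ => ψ τ x) 0 = g x)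
    (hg : ContDiff ℝ 2 g) (hg0 : ∀ x, (x < α ∨ β < x) → g x = 0)
    (hαβ : α ≤ β) {ω T N : ℝ} (hω : 0 < ω) (hT : 0 < T)
    (hres : ∀ x, |(V x - ω ^ 2) * g x - iteratedDeriv 2 g x| ≤ ω * N) :
    ∀ t ∈ Icc 0 T, ∫ x in Ioi β,
      (deriv (fun τ => ψ τ x) t ^ 2 + deriv (ψ t) x ^ 2 + V x * ψ t x ^ 2)
        ≤ (Real.exp 1 - 1) * T ^ 2 * ((β - α) * N ^ 2) := by
  -- the reflected objects
  set Vn : ℝ → ℝ := fun x => V (-x) with hVn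
  set ψn : ℝ → ℝ → ℝ := fun t x => ψ t (-x) with hψn
  set gn : ℝ → ℝ := fun x => g (-x) with hgn
  have hVn1 : ContDiff ℝ 1 Vn := hV1.comp contDiff_neg
  have hVnn' : ∀ x, 0 ≤ Vn x := fun x => hVnn _
  have hψn2 : ContDiff ℝ 2 (uncurry ψn) := by
    have : uncurry ψn = uncurry ψ ∘ fun p : ℝ × ℝ => (p.1, -p.2) := by
      ext p; rfl
    rw [this]
    exact hψ.comp (contDiff_fst.prodMk contDiff_snd.neg)
  have hi2 : ∀ (f : ℝ → ℝ) (x : ℝ), iteratedDeriv 2 (fun y => f (-y)) x = iteratedDeriv 2 f (-x) := by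
    intro f x
    rw [iteratedDeriv_comp_neg 2 f x]
    norm_num
  have hsoln : ∀ t x, iteratedDeriv 2 (fun τ => ψn τ x) t - iteratedDeriv 2 (ψn t) x
      + Vn x * ψn t x = 0 := by
    intro t x
    have h1 : iteratedDeriv 2 (ψn t) x = iteratedDeriv 2 (ψ t) (-x) := hi2 (ψ t) x
    rw [h1]
    exact hsol t (-x)
  have hsuppn : ∀ t x, (x < -β - |t| ∨ -α + |t| < x) → ψn t x = 0 := by
    intro t x hx
    show ψ t (-x) = 0
    apply hsupp
    rcases hx with h | h
    · right; linarith
    · left; linarith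
  have hψn0 : ∀ x, ψn 0 x = 0 := fun x => hψ0 _
  have hψn1 : ∀ x, deriv (fun τ => ψn τ x) 0 = gn x := fun x => hψ1 (-x)
  have hgn2 : ContDiff ℝ 2 gn := hg.comp contDiff_neg
  have hgn0 : ∀ x, (x < -β ∨ -α < x) → gn x = 0 := by
    intro x hx
    show g (-x) = 0
    apply hg0
    rcases hx with h | h
    · right; linarith
    · left; linarith
  have hαβn : -β ≤ -α := by linarith
  have hresn : ∀ x, |(Vn x - ω ^ 2) * gn x - iteratedDeriv 2 gn x| ≤ ω * N := by
    intro x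
    have : iteratedDeriv 2 gn x = iteratedDeriv 2 g (-x) := hi2 g x
    rw [this]
    exact hres (-x)
  have H := near_energy_le_at hVn1 hVnn' hψn2 hsoln hsuppn hψn0 hψn1 hgn2 hgn0 hαβn hω hT hresn
  intro t ht
  have Ht := H t ht
  -- the integrand of the reflected field is the reflected integrand
  set E : ℝ → ℝ := fun y => deriv (fun τ => ψ τ y) t ^ 2 + deriv (ψ t) y ^ 2 + V y * ψ t y ^ 2
    with hE
  have hint : ∀ x, deriv (fun τ => ψn τ x) t ^ 2 + deriv (ψn t) x ^ 2 + Vn x * ψn t x ^ 2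
      = E (-x) := by
    intro x
    have hd : deriv (ψn t) x = -deriv (ψ t) (-x) := deriv_comp_neg (ψ t) x
    rw [hd, neg_sq]
  have hL : (∫ x in Iio (-β), (deriv (fun τ => ψn τ x) t ^ 2 + deriv (ψn t) x ^ 2
      + Vn x * ψn t x ^ 2)) = ∫ x in Ioi β, E x := by
    rw [← integral_Iic_eq_integral_Iio]
    rw [setIntegral_congr_fun measurableSet_Iic (fun x _ => hint x)]
    rw [integral_comp_neg_Iic (-β) E, neg_neg]
  have hR : ((-α) - (-β)) * N ^ 2 = (β - α) * N ^ 2 := by ring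
  rw [hL, hR] at Ht
  exact Ht

open Summit.FinalStateConjecture.FinalStateConjecture.Theorems.Blindness in
/-- **The frozen velocity packet at scale `m`, far-side form.**  Verbatim the landed
`frozen_packet_main` (packet `g(x) = B(m³(x − α))` of width `T = 3/m³` on `[α, xe]`, `α = xe − T`,
`ℓ = m⁴`, global solution `ψ` with data `(0, g)`), except that the conclusion bounds the energy to
the RIGHT of the packet, on `(xe, ∞)`, at the times `±T` — the form needed by the FAR exterior cone
`{x > α + |t|}` whose edge `α + |t|` has swept past the packet at `|t| = T`.  Proof: the original
one with `far_energy_le_at` in place of `near_energy_le_at`. -/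
theorem frozen_packet_far {M : ℝ} {r : ℝ → ℝ} (hM : 0 < M) (hr : ∀ x, 2 * M < r x)
    (hr' : ∀ x, HasDerivAt r (1 - 2 * M / r x) x) (xe : ℝ) {ε : ℝ} (hε : 0 < ε)
    {B : ℝ → ℝ} (hB : ContDiff ℝ 2 B) (h0l : ∀ u, u ≤ 0 → B u = 0)
    (h0r : ∀ u, 3 ≤ u → B u = 0) (h1 : ∀ u ∈ Icc (1 : ℝ) 2, B u = 1)
    (h01 : ∀ u, 0 ≤ B u ∧ B u ≤ 1) {K₂ : ℝ} (hK₂ : 0 ≤ K₂) (hB2 : ∀ u, |iteratedDeriv 2 B u| ≤ K₂)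
    {f₀ C₀ C₁ : ℝ} (hf₀ : 0 < f₀) (hC₁ : 0 ≤ C₁)
    (hlow : ∀ ℓ : ℕ, ∀ x ∈ Icc (xe - 3) xe, (ℓ : ℝ) * ((ℓ : ℝ) + 1) * f₀ - C₀ ≤ (1 - 2 * M / r x) *
        ((ℓ : ℝ) * ((ℓ : ℝ) + 1) / r x ^ 2 + (1 - ((2 : ℕ) : ℝ) ^ 2) * (2 * M) / r x ^ 3))
    (hlip : ∀ ℓ : ℕ, ∀ x ∈ Icc (xe - 3) xe, ∀ y ∈ Icc (xe - 3) xe,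
        |(1 - 2 * M / r x) *
            ((ℓ : ℝ) * ((ℓ : ℝ) + 1) / r x ^ 2 + (1 - ((2 : ℕ) : ℝ) ^ 2) * (2 * M) / r x ^ 3)
          - (1 - 2 * M / r y) *
            ((ℓ : ℝ) * ((ℓ : ℝ) + 1) / r y ^ 2 + (1 - ((2 : ℕ) : ℝ) ^ 2) * (2 * M) / r y ^ 3)|
          ≤ ((ℓ : ℝ) * ((ℓ : ℝ) + 1) + 1) * C₁ * |x - y|)
    {m : ℕ} (hm2 : 2 ≤ m) (hmC : 2 * C₀ / f₀ ≤ m)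
    (hmε : 108 * (9 * C₁ + K₂) ^ 2 / (ε * f₀) ≤ (m : ℝ) ^ 2)
    (ℓ : ℕ) (hℓ : ℓ = m ^ 4) (V : ℝ → ℝ)
    (hV : V = fun x => (1 - 2 * M / r x) *
      ((ℓ : ℝ) * ((ℓ : ℝ) + 1) / r x ^ 2 + (1 - ((2 : ℕ) : ℝ) ^ 2) * (2 * M) / r x ^ 3)) :
    ∃ (g : ℝ → ℝ) (α T : ℝ), ContDiff ℝ 2 g ∧ α < xe ∧ 0 < T ∧ (α = xe - T ∧ T = 3 / (m : ℝ) ^ 3) ∧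
      (∀ x, (x < α ∨ xe < x) → g x = 0) ∧ (∀ x, x ∉ Icc α xe → g x = 0) ∧
      (∀ x, xe ≤ x → g x = 0) ∧
      Integrable (fun x => g x ^ 2) ∧ 0 < ∫ x, g x ^ 2 ∧
      ∃ ψ : ℝ → ℝ → ℝ, ContDiff ℝ 2 (uncurry ψ) ∧
        (∀ t x, iteratedDeriv 2 (fun τ => ψ τ x) t - iteratedDeriv 2 (ψ t) x + V x * ψ t x = 0) ∧
        (∀ x, ψ 0 x = 0) ∧ (∀ x, deriv (fun τ => ψ τ x) 0 = g x) ∧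
        (∀ t x, (x < α - |t| ∨ xe + |t| < x) → ψ t x = 0) ∧
        (∀ t x, 0 ≤ deriv (fun τ => ψ τ x) t ^ 2 + deriv (ψ t) x ^ 2 + V x * ψ t x ^ 2) ∧
        (∀ t, Integrable fun x =>
          deriv (fun τ => ψ τ x) t ^ 2 + deriv (ψ t) x ^ 2 + V x * ψ t x ^ 2) ∧
        (∫ x in Ioi xe, (deriv (fun τ => ψ τ x) T ^ 2 + deriv (ψ T) x ^ 2 + V x * ψ T x ^ 2))
          ≤ ε * ∫ x, g x ^ 2 ∧
        (∫ x in Ioi xe, (deriv (fun τ => ψ τ x) (-T) ^ 2 + deriv (ψ (-T)) x ^ 2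
          + V x * ψ (-T) x ^ 2)) ≤ ε * ∫ x, g x ^ 2 := by
  -- scales
  have hm1 : (1 : ℝ) ≤ m := by exact_mod_cast (le_trans (by norm_num) hm2)
  have hm0 : (0 : ℝ) < m := by linarith
  set c : ℝ := (m : ℝ) ^ 3 with hc
  have hc0 : 0 < c := by positivity
  have hcm : (m : ℝ) ≤ c := by
    rw [hc]; nlinarith [mul_le_mul hm1 hm1 zero_le_one hm0.le]
  have hc1 : 1 ≤ c := hm1.trans hcm
  have h3c' : 3 / c ≤ 3 := by rw [div_le_iff₀ hc0]; nlinarith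
  have h3c0 : 0 < 3 / c := div_pos (by norm_num) hc0
  set ℓr : ℝ := (ℓ : ℝ) * ((ℓ : ℝ) + 1) with hℓr
  have hℓcast : (ℓ : ℝ) = (m : ℝ) ^ 4 := by rw [hℓ]; push_cast; ring
  have hℓr8 : (m : ℝ) ^ 8 ≤ ℓr := by
    rw [hℓr, hℓcast]; nlinarith [pow_nonneg hm0.le 4]
  have hℓr3 : ℓr + 1 ≤ 3 * (m : ℝ) ^ 8 := by
    rw [hℓr, hℓcast]
    have h4 : (1 : ℝ) ≤ (m : ℝ) ^ 4 := one_le_pow₀ hm1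
    nlinarith [pow_nonneg hm0.le 4]
  have hℓrm : (m : ℝ) ≤ ℓr := by
    refine le_trans ?_ hℓr8
    calc (m : ℝ) = (m : ℝ) ^ 1 := (pow_one _).symm
      _ ≤ (m : ℝ) ^ 8 := pow_le_pow_right₀ hm1 (by norm_num)
  have hℓr0 : 0 < ℓr := lt_of_lt_of_le hm0 hℓrm
  have hℓ2 : 2 ≤ ℓ := by
    rw [hℓ]; calc 2 ≤ 2 ^ 4 := by norm_num
      _ ≤ m ^ 4 := Nat.pow_le_pow_left hm2 4
  -- the potential
  subst hV
  have hV1 := contDiff_one_potential hM hr hr' ℓ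
  have hVpos := potential_pos hM hr hℓ2
  have hVnn : ∀ x, 0 ≤ (1 - 2 * M / r x) *
      ((ℓ : ℝ) * ((ℓ : ℝ) + 1) / r x ^ 2 + (1 - ((2 : ℕ) : ℝ) ^ 2) * (2 * M) / r x ^ 3) :=
    fun x => (hVpos x).le
  have hVb := abs_potential_le hM hr ℓ
  set Vf : ℝ → ℝ := fun x => (1 - 2 * M / r x) *
      ((ℓ : ℝ) * ((ℓ : ℝ) + 1) / r x ^ 2 + (1 - ((2 : ℕ) : ℝ) ^ 2) * (2 * M) / r x ^ 3) with hVf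
  -- the profile: `g(x) = B(c(x − α))`, `α = xe − 3/c`
  set α : ℝ := xe - 3 / c with hα
  have hαxe : α + 3 / c = xe := by rw [hα]; ring
  have hαlt : α < xe := by rw [hα]; linarith
  obtain ⟨hg2, hg0l, hg0r, hg1, hg01, hg''⟩ := scaled_profile hB h0l h0r h1 h01 hc0 α
  set g : ℝ → ℝ := fun x => B (c * (x - α)) with hg
  rw [hαxe] at hg0r
  have hgoff : ∀ x, x ∉ Icc α xe → g x = 0 := by
    intro x hx
    by_cases h : x ≤ α
    · exact hg0l x h
    · exact hg0r x (le_of_not_ge fun h' => hx ⟨le_of_not_ge h, h'⟩)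
  have hgoff' : ∀ x, (x < α ∨ xe < x) → g x = 0 :=
    fun x hx => hgoff x fun h => by rcases hx with hx | hx <;> linarith [h.1, h.2]
  have hgint : Integrable fun x => g x ^ 2 :=
    integrable_of_exterior (a := α) (b := xe) (hg2.continuous.pow 2)
      (fun x hx => by simp [hgoff' x hx])
  -- `∫ g² ≥ 1/c`
  have hE0low : 1 / c ≤ ∫ x, g x ^ 2 := by
    have hstep2 : (∫ x in Icc (α + 1 / c) (α + 2 / c), g x ^ 2) ≤ ∫ x, g x ^ 2 :=
      setIntegral_le_integral hgint (Eventually.of_forall fun x => sq_nonneg _)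
    refine le_trans (le_of_eq ?_) hstep2
    have h1c : α + 1 / c ≤ α + 2 / c := by
      have : 1 / c ≤ 2 / c := div_le_div_of_nonneg_right (by norm_num) hc0.le
      linarith
    rw [setIntegral_congr_fun measurableSet_Icc (g := fun _ => (1 : ℝ))
      (fun x hx => by rw [show g x = 1 from hg1 x hx]; norm_num), setIntegral_const,
      Real.volume_real_Icc_of_le h1c, smul_eq_mul, mul_one]
    ring
  have hE0pos : 0 < ∫ x, g x ^ 2 := lt_of_lt_of_le (by positivity) hE0low
  -- the solution with data `(0, g)`
  obtain ⟨ψ, hψ2, hsol, hψ0, hψ1, hsupp⟩ :=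
    CauchyWave.exists_solution (A := fun _ => 0) (B := g) (α := α) (β := xe) hV1 hVb
      contDiff_const (fun _ _ => rfl) (hg2.of_le (by norm_num)) hgoff
  have he0 : ∀ t x, 0 ≤ deriv (fun τ => ψ τ x) t ^ 2 + deriv (ψ t) x ^ 2 + Vf x * ψ t x ^ 2 :=
    fun t x => by have := mul_nonneg (hVnn x) (sq_nonneg (ψ t x)); positivity
  have hInt : ∀ t, Integrable fun x =>
      deriv (fun τ => ψ τ x) t ^ 2 + deriv (ψ t) x ^ 2 + Vf x * ψ t x ^ 2 :=
    fun t => integrable_energyDensity hV1.continuous hψ2 hsupp t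
  -- the frequency `ω² = V(α)` and the residual bound `ω N = 3(ℓr+1)C₁/c + c²K₂`
  set ω : ℝ := Real.sqrt (Vf α) with hω
  have hω0 : 0 < ω := Real.sqrt_pos.2 (hVpos α)
  have hω2 : ω ^ 2 = Vf α := Real.sq_sqrt (hVnn α)
  set N' : ℝ := 3 * (ℓr + 1) * C₁ / c + c ^ 2 * K₂ with hN'
  have hN'0 : 0 ≤ N' := by positivity
  set N : ℝ := N' / ω with hN
  have hN0 : 0 ≤ N := div_nonneg hN'0 hω0.le
  have hωN : ω * N = N' := by rw [hN]; field_simp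
  have hres_g : ∀ x, |(Vf x - ω ^ 2) * g x - iteratedDeriv 2 g x| ≤ ω * N := by
    intro x
    rw [hωN]
    by_cases hx : x ∈ Icc α xe
    · have hxK : x ∈ Icc (xe - 3) xe := ⟨by rw [hα] at hx; linarith [hx.1], hx.2⟩
      have hαK : α ∈ Icc (xe - 3) xe := ⟨by rw [hα]; linarith, hαlt.le⟩
      have hVd : |Vf x - Vf α| ≤ (ℓr + 1) * C₁ * (3 / c) := by
        refine (hlip ℓ x hxK α hαK).trans ?_
        rw [abs_of_nonneg (by linarith [hx.1])]
        exact mul_le_mul_of_nonneg_left (by rw [hα] at hx ⊢; linarith [hx.2]) (by positivity)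
      have hgx : |g x| ≤ 1 := by
        rw [abs_of_nonneg (hg01 x).1]; exact (hg01 x).2
      have hg''x : |iteratedDeriv 2 g x| ≤ c ^ 2 * K₂ := by
        rw [hg'' x, abs_mul, abs_of_nonneg (by positivity)]
        exact mul_le_mul_of_nonneg_left (hB2 _) (by positivity)
      rw [hω2]
      calc |(Vf x - Vf α) * g x - iteratedDeriv 2 g x|
          ≤ |(Vf x - Vf α) * g x| + |iteratedDeriv 2 g x| := abs_sub _ _
        _ = |Vf x - Vf α| * |g x| + |iteratedDeriv 2 g x| := by rw [abs_mul]
        _ ≤ (ℓr + 1) * C₁ * (3 / c) * 1 + c ^ 2 * K₂ :=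
            add_le_add (mul_le_mul hVd hgx (abs_nonneg _) (by positivity)) hg''x
        _ = N' := by rw [hN']; ring
    · have hx' : x < α ∨ xe < x := by
        by_contra h
        exact hx ⟨le_of_not_gt fun h' => h (Or.inl h'), le_of_not_gt fun h' => h (Or.inr h')⟩
      have hgev : g =ᶠ[𝓝 x] fun _ => (0 : ℝ) := by
        rcases hx' with hx' | hx'
        · filter_upwards [Iio_mem_nhds hx'] with y hy using hgoff' y (Or.inl hy)
        · filter_upwards [Ioi_mem_nhds hx'] with y hy using hgoff' y (Or.inr hy)
      rw [hgoff x hx, iteratedDeriv_two_eq_zero_of_eventuallyEq hgev]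
      simp [hN'0]
  -- the same bound for `−g` (data of the time-reversed solution)
  have hres_ng : ∀ x, |(Vf x - ω ^ 2) * (-g x) - iteratedDeriv 2 (fun y => -g y) x| ≤ ω * N := by
    intro x
    rw [iteratedDeriv_fun_neg 2 g x]
    have h := hres_g x
    rwa [← abs_neg, show -((Vf x - ω ^ 2) * g x - iteratedDeriv 2 g x)
      = (Vf x - ω ^ 2) * (-g x) - -iteratedDeriv 2 g x by ring] at h
  -- the near-side bounds at `T = 3/c` and `−T`
  set T : ℝ := 3 / c with hT
  have hTmem : T ∈ Icc 0 T := ⟨h3c0.le, le_rfl⟩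
  have hplus := far_energy_le_at hV1 hVnn hψ2 hsol hsupp hψ0 hψ1 hg2 hgoff' hαlt.le hω0 h3c0
    hres_g T hTmem
  obtain ⟨hψr2, hsolr, hsuppr, hψr0, hψr1, her⟩ := time_reverse hψ2 hsol hsupp hψ0 hψ1
  have hminus' := far_energy_le_at (ψ := fun s y => ψ (-s) y) hV1 hVnn hψr2 hsolr hsuppr hψr0
    hψr1 hg2.neg (fun x hx => by rw [hgoff' x hx, neg_zero]) hαlt.le hω0 h3c0 hres_ng T hTmem
  have hminus : (∫ x in Ioi xe, (deriv (fun τ => ψ τ x) (-T) ^ 2 + deriv (ψ (-T)) x ^ 2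
      + Vf x * ψ (-T) x ^ 2)) ≤ (Real.exp 1 - 1) * T ^ 2 * ((xe - α) * N ^ 2) := by
    rw [← setIntegral_congr_fun measurableSet_Ioi (fun x _ => her T x)]
    exact hminus'
  -- bookkeeping: `(e − 1) T² (xe − α) N² ≤ ε/c ≤ ε ∫ g²`
  have hexp2 : Real.exp 1 - 1 ≤ 2 := by
    have := Real.exp_one_lt_d9; norm_num at this; linarith
  have hexp0 : 0 ≤ Real.exp 1 - 1 := by linarith [Real.add_one_le_exp (1:ℝ)]
  have hN'D : N' ≤ (9 * C₁ + K₂) * (m : ℝ) ^ 6 := by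
    have ha : 3 * (ℓr + 1) * C₁ ≤ 9 * (m : ℝ) ^ 8 * C₁ := by
      have := mul_le_mul_of_nonneg_right hℓr3 hC₁
      linarith
    have hb : 3 * (ℓr + 1) * C₁ / c ≤ 9 * (m : ℝ) ^ 8 * C₁ / c :=
      div_le_div_of_nonneg_right ha hc0.le
    have hc' : 9 * (m : ℝ) ^ 8 * C₁ / c = 9 * C₁ * (m : ℝ) ^ 5 := by
      rw [div_eq_iff hc0.ne', hc]; ring
    have hd : 9 * C₁ * (m : ℝ) ^ 5 ≤ 9 * C₁ * (m : ℝ) ^ 6 :=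
      mul_le_mul_of_nonneg_left (pow_le_pow_right₀ hm1 (by norm_num)) (by positivity)
    have he : c ^ 2 * K₂ = K₂ * (m : ℝ) ^ 6 := by rw [hc]; ring
    rw [hN', he]
    linarith
  -- `ω² ≥ ℓr f₀ / 2 ≥ m⁸ f₀ / 2`
  have hω2low : (m : ℝ) ^ 8 * f₀ / 2 ≤ ω ^ 2 := by
    rw [hω2]
    have hαK : α ∈ Icc (xe - 3) xe := ⟨by rw [hα]; linarith, hαlt.le⟩
    have h := hlow ℓ α hαK
    have hℓf : 2 * C₀ ≤ ℓr * f₀ := by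
      have h1 : 2 * C₀ ≤ (m : ℝ) * f₀ := by rwa [div_le_iff₀ hf₀] at hmC
      exact h1.trans (mul_le_mul_of_nonneg_right hℓrm hf₀.le)
    have h8 : (m : ℝ) ^ 8 * f₀ ≤ ℓr * f₀ := mul_le_mul_of_nonneg_right hℓr8 hf₀.le
    refine le_trans ?_ h
    change (m : ℝ) ^ 8 * f₀ / 2 ≤ ℓr * f₀ - C₀
    linarith
  -- `N² ≤ 2 (9C₁+K₂)² m⁴ / f₀`
  have hN2 : N ^ 2 ≤ 2 * (9 * C₁ + K₂) ^ 2 * (m : ℝ) ^ 4 / f₀ := by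
    have hD : 0 ≤ 9 * C₁ + K₂ := by positivity
    have h1 : N ^ 2 = N' ^ 2 / ω ^ 2 := by rw [hN, div_pow]
    have h2 : N' ^ 2 ≤ (9 * C₁ + K₂) ^ 2 * (m : ℝ) ^ 12 := by
      calc N' ^ 2 ≤ ((9 * C₁ + K₂) * (m : ℝ) ^ 6) ^ 2 := pow_le_pow_left₀ hN'0 hN'D 2
        _ = (9 * C₁ + K₂) ^ 2 * (m : ℝ) ^ 12 := by ring
    rw [h1, div_le_div_iff₀ (by positivity) hf₀]
    calc N' ^ 2 * f₀ ≤ (9 * C₁ + K₂) ^ 2 * (m : ℝ) ^ 12 * f₀ :=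
          mul_le_mul_of_nonneg_right h2 hf₀.le
      _ = 2 * (9 * C₁ + K₂) ^ 2 * (m : ℝ) ^ 4 * ((m : ℝ) ^ 8 * f₀ / 2) := by ring
      _ ≤ 2 * (9 * C₁ + K₂) ^ 2 * (m : ℝ) ^ 4 * ω ^ 2 :=
          mul_le_mul_of_nonneg_left hω2low (by positivity)
  have hkey : (Real.exp 1 - 1) * T ^ 2 * ((xe - α) * N ^ 2) ≤ ε * ∫ x, g x ^ 2 := by
    have hxeα : xe - α = 3 / c := by rw [hα]; ring
    have hcc : c ^ 3 = (m : ℝ) ^ 9 := by rw [hc]; ring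
    -- the largeness condition `108 (9C₁+K₂)² ≤ ε f₀ m²`
    have hm' : 108 * (9 * C₁ + K₂) ^ 2 ≤ ε * f₀ * (m : ℝ) ^ 2 := by
      have h := hmε
      rw [div_le_iff₀ (mul_pos hε hf₀)] at h
      linarith only [h]
    have hstep : (Real.exp 1 - 1) * T ^ 2 * ((xe - α) * N ^ 2) ≤ ε * (1 / c) := by
      rw [hxeα, hT]
      calc (Real.exp 1 - 1) * (3 / c) ^ 2 * (3 / c * N ^ 2)
          = (Real.exp 1 - 1) * (27 * N ^ 2 / c ^ 3) := by field_simp; ring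
        _ ≤ 2 * (27 * N ^ 2 / c ^ 3) := mul_le_mul_of_nonneg_right hexp2 (by positivity)
        _ ≤ 2 * (27 * (2 * (9 * C₁ + K₂) ^ 2 * (m : ℝ) ^ 4 / f₀) / c ^ 3) := by gcongr
        _ = 108 * (9 * C₁ + K₂) ^ 2 * (m : ℝ) ^ 4 / (f₀ * (m : ℝ) ^ 9) := by
            rw [hcc]; field_simp; ring
        _ ≤ ε * f₀ * (m : ℝ) ^ 2 * (m : ℝ) ^ 4 / (f₀ * (m : ℝ) ^ 9) := by gcongr
        _ = ε * (1 / c) := by rw [hc]; field_simp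
    exact hstep.trans (mul_le_mul_of_nonneg_left hE0low hε.le)
  -- assemble
  refine ⟨g, α, T, hg2, hαlt, h3c0, ⟨by rw [hT, hα], by rw [hT, hc]⟩, hgoff', hgoff, hg0r, hgint,
    hE0pos, ψ, hψ2,
    hsol, hψ0, hψ1, hsupp, he0, hInt, hplus.trans hkey, hminus.trans hkey⟩

/-! ### The far-edge packets through the two-ended channel -/

section Channel

open Literature.Geometry.Lorentzian Literature.Geometry.Lorentzian.ReggeWheeler
open scoped ENNReal

/-- Channel energies are dominated by the exterior energy at any time beyond which the exterior
energy is monotone (the liminf along `atTop`/`atBot` is eventually below it). -/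
theorem channelEnergy_le_of_antitone' {V : ℝ → ℝ} {xc ρ : ℝ} {ψ : ℝ → ℝ → ℝ}
    (h : AntitoneOn (exteriorEnergy V xc ρ ψ) (Ici 0) ∧ MonotoneOn (exteriorEnergy V xc ρ ψ) (Iic 0))
    {t₁ : ℝ} (ht₁ : 0 ≤ t₁) :
    channelEnergy V xc ρ ψ atTop ≤ exteriorEnergy V xc ρ ψ t₁ ∧
      channelEnergy V xc ρ ψ atBot ≤ exteriorEnergy V xc ρ ψ (-t₁) := by
  constructor
  · refine liminf_le_of_frequently_le' (Eventually.frequently ?_)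
    filter_upwards [eventually_ge_atTop t₁] with t ht
    exact h.1 (mem_Ici.2 ht₁) (mem_Ici.2 (ht₁.trans ht)) ht
  · refine liminf_le_of_frequently_le' (Eventually.frequently ?_)
    filter_upwards [eventually_le_atBot (-t₁)] with t ht
    exact h.2 (mem_Iic.2 (ht.trans (by linarith))) (mem_Iic.2 (by linarith)) ht

/-- **From the far-side integral to the two-ended exterior energy.** For `ρ ≥ 0` and a `C²` field
vanishing outside the domain of influence of `[xc + ρ, xe]`, at a time `t` with
`xe ≤ xc + ρ + |t|` the exterior energy `∫_{ρ+|t|<|x−xc|} e(t, x) dx` is the energy on a part of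
`(xe, ∞)` (the near half-line `x < xc − ρ − |t|` carries nothing), hence it is bounded by any bound
`b` on `∫_{(xe, ∞)} e(t, x) dx`. -/
theorem exteriorEnergy_le_of_far {V : ℝ → ℝ} {ψ : ℝ → ℝ → ℝ} {xc ρ xe t b : ℝ} (hρ : 0 ≤ ρ)
    (hedge : xe ≤ xc + ρ + |t|) (hψ2 : ContDiff ℝ 2 (uncurry ψ))
    (hsupp : ∀ s x, (x < (xc + ρ) - |s| ∨ xe + |s| < x) → ψ s x = 0)
    (he0 : ∀ x, 0 ≤ deriv (fun τ => ψ τ x) t ^ 2 + deriv (ψ t) x ^ 2 + V x * ψ t x ^ 2)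
    (hInt : Integrable fun x => deriv (fun τ => ψ τ x) t ^ 2 + deriv (ψ t) x ^ 2 + V x * ψ t x ^ 2)
    (hb : ∫ x in Ioi xe, (deriv (fun τ => ψ τ x) t ^ 2 + deriv (ψ t) x ^ 2 + V x * ψ t x ^ 2) ≤ b) :
    exteriorEnergy V xc ρ ψ t ≤ ENNReal.ofReal b := by
  unfold exteriorEnergy
  have hd : 0 ≤ ρ + |t| := add_nonneg hρ (abs_nonneg t)
  rw [WaveEnergy.lintegral_setOf_lt_abs_sub xc hd]
  -- the near half-line carries no energy
  have hnear : ∫⁻ x in Iio (xc - (ρ + |t|)), ENNReal.ofReal (energyDensity V ψ t x) = 0 := by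
    refine setLIntegral_eq_zero measurableSet_Iio fun x hx => ?_
    simp only [mem_Iio] at hx
    have hx' : x < (xc + ρ) - |t| ∨ xe + |t| < x := Or.inl (by linarith)
    show ENNReal.ofReal (energyDensity V ψ t x) = 0
    unfold energyDensity
    rw [energyDensity_eq_zero_of_exterior hψ2 hsupp hx', ENNReal.ofReal_zero]
  rw [hnear, zero_add]
  -- the far half-line lies beyond `xe`
  have hsub : Ioi (xc + (ρ + |t|)) ⊆ Ioi xe := fun x hx => by
    simp only [mem_Ioi] at hx ⊢
    linarith
  refine (lintegral_mono_set hsub).trans ?_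
  unfold energyDensity
  rw [← ofReal_integral_eq_lintegral_ofReal hInt.integrableOn (Eventually.of_forall he0)]
  exact ENNReal.ofReal_le_ofReal hb

open Summit.FinalStateConjecture.FinalStateConjecture.Theorems.Blindness in
/-- **Far-edge frozen packets have arbitrarily small two-ended channel energy** (negative-side
support for K1R, item stmt-FinalStateConjecture-14074; this seat).  For every tortoise radius
function, every ball radius `ρ ≥ 0` and every `ε > 0`, for ALL sufficiently large `m`, the spin-2
mode `ℓ = m⁴` carries a velocity packet `(0, g)`, `g ≠ 0`, supported in `[xc + ρ, xc + ρ + 3/m³]`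
(flush inside the FAR edge of the cone `{ρ + |t| < |x − xc|}`), whose global Regge–Wheeler
solution radiates at most `ε ∫ g²` through the forward channel ends and at most `ε ∫ g²` through
the backward ones.  Hence ANY channel inequality at `(ρ, ℓ)` with constant `c` forces the kernel
deficit of these packets below `(2ε/c) ∫ g²`: on the far side the `t`-polynomial kernel must
absorb edge rest packets (its velocity towers are nonzero, unlike the near side where this
packet family refuted K1).  The edge `xc + ρ` is arbitrary: the log-ball of K1R only delays the
family to larger `m` (see `farAbsorption_of_uniformR` in the crux Disproof file). -/
theorem far_frozen_channel_small {M : ℝ} {r : ℝ → ℝ} {xc : ℝ} (hr : IsTortoiseRadius M r xc)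
    {ρ : ℝ} (hρ : 0 ≤ ρ) {ε : ℝ} (hε : 0 < ε) :
    ∃ m₀ : ℕ, 2 ≤ m₀ ∧ ∀ m : ℕ, m₀ ≤ m →
      ∃ (g : ℝ → ℝ) (T : ℝ), T = 3 / (m : ℝ) ^ 3 ∧ ContDiff ℝ 2 g ∧
        (∀ x, x ∉ Icc (xc + ρ) (xc + ρ + T) → g x = 0) ∧ Integrable (fun x => g x ^ 2) ∧
        0 < ∫ x, g x ^ 2 ∧
        ∃ ψ : ℝ → ℝ → ℝ, IsRWSolution M 2 (m ^ 4) r ψ ∧ (∀ x, ψ 0 x = 0) ∧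
          (∀ x, deriv (fun τ => ψ τ x) 0 = g x) ∧
          (∀ t x, (x < xc + ρ - |t| ∨ xc + ρ + T + |t| < x) → ψ t x = 0) ∧
          channelEnergy (linePotential M 2 (m ^ 4) r) xc ρ ψ atTop
              ≤ ENNReal.ofReal (ε * ∫ x, g x ^ 2) ∧
          channelEnergy (linePotential M 2 (m ^ 4) r) xc ρ ψ atBot
              ≤ ENNReal.ofReal (ε * ∫ x, g x ^ 2) := by
  have hM := hr.mass_pos
  set e : ℝ := xc + ρ with he_def
  -- the bump and the constants of the potential on `[e − 3, e + 3]`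
  obtain ⟨B, hB, h0l, h0r, h1, h01, K₂, hK₂, hB2⟩ := exists_profile
  obtain ⟨f₀, C₀, C₁, hf₀, hC₀, hC₁, hKV⟩ :=
    potential_compact_bounds hM hr.two_mul_lt hr.hasDerivAt (a := e - 3) (b := e + 3) (by linarith)
  obtain ⟨m₁, hm₁⟩ := exists_nat_gt (max 2
    (max (2 * C₀ / f₀) (Real.sqrt (108 * (9 * C₁ + K₂) ^ 2 / (ε * f₀)))))
  refine ⟨m₁, ?_, fun m hm => ?_⟩
  · have : (2 : ℝ) < m₁ := lt_of_le_of_lt (le_max_left _ _) hm₁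
    have : (2 : ℕ) < m₁ := by exact_mod_cast this
    omega
  have hmr : (m₁ : ℝ) ≤ m := by exact_mod_cast hm
  have hm2r : (2 : ℝ) < m := lt_of_lt_of_le (lt_of_le_of_lt (le_max_left _ _) hm₁) hmr
  have hm2 : 2 ≤ m := by
    have : (2 : ℕ) < m := by exact_mod_cast hm2r
    omega
  have hm0 : (0 : ℝ) < m := by linarith
  have hm1 : (1 : ℝ) ≤ m := by linarith
  have hmC : 2 * C₀ / f₀ ≤ m :=
    ((lt_of_le_of_lt ((le_max_left _ _).trans (le_max_right _ _)) hm₁).le).trans hmr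
  have hmε : 108 * (9 * C₁ + K₂) ^ 2 / (ε * f₀) ≤ (m : ℝ) ^ 2 := by
    have h := lt_of_le_of_lt ((le_max_right _ _).trans (le_max_right _ _)) hm₁
    have h' : Real.sqrt (108 * (9 * C₁ + K₂) ^ 2 / (ε * f₀)) < m := lt_of_lt_of_le h hmr
    exact ((Real.sqrt_lt' hm0).1 h').le
  have hℓ2 : 2 ≤ m ^ 4 := le_trans hm2 (Nat.le_self_pow (by norm_num) m)
  -- the right end of the packet
  set xe : ℝ := e + 3 / (m : ℝ) ^ 3 with hxe_def
  have h3 : 0 < 3 / (m : ℝ) ^ 3 := by positivity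
  have h3' : 3 / (m : ℝ) ^ 3 ≤ 3 := by
    rw [div_le_iff₀ (by positivity)]
    have : (1 : ℝ) ≤ (m : ℝ) ^ 3 := one_le_pow₀ hm1
    nlinarith
  have hsubK : Icc (xe - 3) xe ⊆ Icc (e - 3) (e + 3) := by
    intro x hx
    exact ⟨by linarith [hx.1], by linarith [hx.2]⟩
  -- the packet
  obtain ⟨g, α, T, hg2, -, hT0, ⟨hαeq, hTeq⟩, -, hgoff, -, hgint, hgpos, ψ, hψ2, hsol, hψ0, hψ1,
      hsupp, he0, hInt, hplus, hminus⟩ :=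
    frozen_packet_far hM hr.two_mul_lt hr.hasDerivAt xe hε hB h0l h0r h1 h01 hK₂ hB2 hf₀ hC₁
      (fun ℓ x hx => (hKV ℓ).1 x (hsubK hx))
      (fun ℓ x hx y hy => (hKV ℓ).2 x (hsubK hx) y (hsubK hy)) hm2 hmC hmε (m ^ 4) rfl
      (linePotential M 2 (m ^ 4) r) rfl
  have hαe : α = e := by rw [hαeq, hTeq, hxe_def]; ring
  have hxeT : xe = e + T := by rw [hTeq, hxe_def]
  have hψsol : IsRWSolution M 2 (m ^ 4) r ψ := ⟨hψ2, fun z => hsol z.1 z.2⟩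
  refine ⟨g, T, hTeq, hg2, ?_, hgint, hgpos, ψ, hψsol, hψ0, hψ1, ?_, ?_⟩
  · intro x hx
    apply hgoff x
    rwa [hαe, hxeT]
  · intro t x hx
    apply hsupp t x
    rwa [hαe, hxeT]
  -- exterior energies at `±T`, then monotonicity
  have hsupp' : ∀ s x, (x < (xc + ρ) - |s| ∨ xe + |s| < x) → ψ s x = 0 := by
    intro s x hx; apply hsupp s x; rwa [hαe]
  have hedgeT : xe ≤ xc + ρ + |T| := by rw [abs_of_pos hT0, hxeT]
  have hedgeT' : xe ≤ xc + ρ + |(-T)| := by rw [abs_neg, abs_of_pos hT0, hxeT]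
  have hup := exteriorEnergy_le_of_far hρ hedgeT hψ2 hsupp' (he0 T) (hInt T) hplus
  have hdown := exteriorEnergy_le_of_far hρ hedgeT' hψ2 hsupp' (he0 (-T)) (hInt (-T)) hminus
  have hmono := RW.exteriorEnergy_antitoneOn_rw hr hℓ2 hψsol xc hρ
  obtain ⟨h1', h2'⟩ := channelEnergy_le_of_antitone' hmono hT0.le
  exact ⟨h1'.trans hup, h2'.trans hdown⟩

end Channel


/-- **What K1R demands of the far kernel** (item stmt-FinalStateConjecture-14074).  If
`UniformPhotonSphereChannelsR` holds with witnesses `(ρ₀, C, c)` at `M`, then at every far edge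
`xc + ρ` inside the log-ball regime (`ρ₀ + C log(m⁴+1) ≤ ρ`) the far-edge frozen packets of
`far_frozen_channel_small` have kernel deficit `≤ (2ε/c) ∫ g²` for every `ε > 0` and all large
`m`: the `t`-polynomial kernel (its velocity towers `N¹`, of dimension `⌊(2ℓ+3)/4⌋`) must absorb
edge rest packets in `L²(xc + ρ, ∞)` to arbitrary relative accuracy, uniformly along the family.
This is the exact far-side content of the crux; the seat's numerics (kern.py + spec.py, flat
identity reproduced to 0.1 %) find the absorption WITH `(E⁺+E⁻)/dist² ≈ 0.95–1.00` at
`ℓ = 64`, i.e. no violation. -/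
theorem farAbsorption_of_uniformR
    (h : Summit.FinalStateConjecture.FinalStateConjecture.Theses.PhotonSphereChannels.UniformPhotonSphereChannelsR)
    {M : ℝ} (hM : 0 < M) :
    ∃ ρ₀ : ℝ, 0 ≤ ρ₀ ∧ ∃ C : ℝ, 0 ≤ C ∧ ∃ c : ℝ, 0 < c ∧
      ∀ (r : ℝ → ℝ) (xc : ℝ), IsTortoiseRadius M r xc → ∀ ρ : ℝ, 0 ≤ ρ → ∀ ε : ℝ, 0 < ε →
        ∃ m₀ : ℕ, 2 ≤ m₀ ∧ ∀ m : ℕ, m₀ ≤ m → ρ₀ + C * Real.log (((m ^ 4 : ℕ) : ℝ) + 1) ≤ ρ →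
          ∃ (g : ℝ → ℝ) (T : ℝ), T = 3 / (m : ℝ) ^ 3 ∧ ContDiff ℝ 2 g ∧
            (∀ x, x ∉ Icc (xc + ρ) (xc + ρ + T) → g x = 0) ∧ 0 < ∫ x, g x ^ 2 ∧
            ∃ ψ : ℝ → ℝ → ℝ, IsRWSolution M 2 (m ^ 4) r ψ ∧ (∀ x, ψ 0 x = 0) ∧
              (∀ x, deriv (fun τ => ψ τ x) 0 = g x) ∧
              ENNReal.ofReal c * kernelDeficit (linePotential M 2 (m ^ 4) r) xc ρ ψ
                ≤ ENNReal.ofReal (2 * ε * ∫ x, g x ^ 2) := by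
  obtain ⟨ρ₀, hρ₀, C, hC, c, hc, H⟩ := h M hM
  refine ⟨ρ₀, hρ₀, C, hC, c, hc, fun r xc hr ρ hρ ε hε => ?_⟩
  obtain ⟨m₀, hm₀, hm⟩ := far_frozen_channel_small hr hρ hε
  refine ⟨m₀, hm₀, fun m hmm hlog => ?_⟩
  obtain ⟨g, T, hT, hg2, hgoff, -, hgpos, ψ, hψ, hψ0, hψ1, -, hup, hdown⟩ := hm m hmm
  refine ⟨g, T, hT, hg2, hgoff, hgpos, ψ, hψ, hψ0, hψ1, ?_⟩
  have hℓ : 2 ≤ m ^ 4 := le_trans (le_trans hm₀ hmm) (Nat.le_self_pow (by norm_num) m)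
  have hK := H r xc hr 2 (m ^ 4) le_rfl hℓ ρ hlog ψ hψ
  refine hK.trans ?_
  calc channelEnergy (linePotential M 2 (m ^ 4) r) xc ρ ψ atTop
        + channelEnergy (linePotential M 2 (m ^ 4) r) xc ρ ψ atBot
      ≤ ENNReal.ofReal (ε * ∫ x, g x ^ 2) + ENNReal.ofReal (ε * ∫ x, g x ^ 2) := add_le_add hup hdown
    _ = ENNReal.ofReal (2 * ε * ∫ x, g x ^ 2) := by
        rw [← ENNReal.ofReal_add (by positivity) (by positivity)]
        ring_nf


end FarFrozen

end Summit.FinalStateConjecture.FinalStateConjecture.Cruxes.UniformPhotonSphereChannelsR.Disproof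

end
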